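import Summits.QuantumFields.YangMills.Theorems.BalabanUVNodesN07SplitClauseOfShearSize
import HarnessLib

/-!
# N07 [B11] (= [15] = [Balaban1985Variational]) Sect. F, road of record R0′, WIDTH-209 row (r2), FILE 8: **THE RECORD EDITION OF THE S6 HEAD's R0′ SPLIT CLAUSE
# WITH A SIGN-FREE (NORM-DOMINATED) SHEAR FAMILY** — FILE 7's `localGaugeSplitOn_of_gauge152_recordShear_adm22_T4` pinned the family to `λ_j(y) = log ĝ_j(y)⁻¹` by an
# equality; but the (r1) shift summand of dag-n07-w6's composed row is `log ĝ(c₋)⁻¹ − log ĝ(c₊)⁻¹ = −∂(log ĝ⁻¹)(c)` while V1's coarse gradient is `∂^{c}f(b) = c•(f(b₊) − f(b₋))`,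
# so with the (159) identity in the head's form `A − H_V X = A₁ + A₂ − A₃` the datum `X` is the coarse gradient of `−log ĝ⁻¹` (LOCATED-SIGN, cell bus I.36116).  This file
# re-keys the record door on the binder `‖λ_j(y)‖ ≤ ‖log ĝ_j(y)⁻¹‖` (covers `±log ĝ⁻¹` and any pointwise-dominated reparametrisation), states the (r1) orientation
# `λ_j := −log ĝ_j⁻¹` as a corollary, and records the A6 non-vacuity of the binder (`u♮ = 1` ⇒ the letter family is `0`)

Cell `pub-ymgap`, width seat `pub-ymgap-dag-n07-w8` g4, WIDTH-209 N07 row (r2) of road R0′, CLAIM-8 ∕ INTENT-8 (cell bus I.36116; own lineage FILE 7 p625131 ✓ → FILE 8).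
`--kind proof --supports stmt-QuantumFields-27364 --as helper` (K1⁹ per dag-lead KEY MAP v2 ∕ GATE v1.69); count-neutral; def-free.
[15] = T. Bałaban, Commun. Math. Phys. **102** (1985) 277–309 [Balaban1985Variational]; [4] = [Balaban1984PropagatorsII] (CMP **96** (1984) 223–250); [I.4] =
[Balaban1984PropagatorsI] (CMP **95** (1984) 17–40); [3] = [Balaban1985Averaging] (CMP **98** (1985) 17–51).

WHAT IS PROVED (sorry-free; no definition; axioms standard; all BY NAME over FILE 7).
* ★★★ `localGaugeSplitOn_of_gauge152_recordShear_dominated_adm22_T4 F N` — FILE 7 §3 VERBATIM except the family binder, now `∀ j y, ‖λ_j(y)‖ ≤ ‖log ĝ_j(y)⁻¹‖`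
  (`ĝ_j := g_j(castSite lo_j)⁻¹·g_j`, `g_j := u♮↾T^{(j)}`): averaging of record, per-level boxes `[lo_j, hi_j]` with PER-LEVEL bond letters `v_j` (data `M^j(U₁^{u♮})`) and
  `a_j` (averages `M^j(U₁)`), a uniform `σ` with `D_j·(v_j + a_j) ≤ σ ≤ ½` (`j ≤ K − n`), the three box-membership facts (outer end-points; `Λ_j`-sites for `j ≥ 1`; fine
  `Λ₀`-sites under outer end-points), the datum `X` the coarse gradient of `λ`, S3's gauge of `U` on the window with (152) letters `t`, the (159)-splitting
  `A − H_V X = A₁ + A₂ − A₃` with letters `t₁, t₂, t₃` ⇒ `LocalGaugeSplitOn Y η_{K−n} t (t₁ + (t₂ + t_∂) + t₃) U` for EVERY `t_∂ > 2CB₃·(4σ)` (∘ FILE 7's sharp door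
  `localGaugeSplitOn_of_gauge152_coarseShift_levLift_under_adm22_T4` + `norm_mlog_centredShear_inv_le_box_record` + `iterBlockOf_levOf_mem_of_lamSite`).
* ★ `localGaugeSplitOn_of_gauge152_recordShear_neg_adm22_T4 F N` — THE (r1) ORIENTATION: the family `λ_j(y) = −log ĝ_j(y)⁻¹`, whose coarse gradient
  `∂^{(j)}λ_j(c) = L^{(K−n)−j}·(log ĝ_j(c₋)⁻¹ − log ĝ_j(c₊)⁻¹)` IS the shift summand of `N07ShearSizeTopBox.norm_mlog_iter_avOfRecord_centred_sub_le` in potential units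
  (`norm_neg` ∘ the dominated door).
* `mlog_centredShear_inv_one` — A6 NON-VACUITY of the binder: at `u♮ = 1` the letter family vanishes identically (`u♮↾T^{(j)} = 1`, `MatrixLog.mlog_one`), so
  `λ := 0` meets the dominated binder for ANY boxes and letters (and then `X = 0`: the clause is FILE 6's with no shift).
HONEST SCOPE.  Count-neutral re-keying of FILE 7's record door; DISPLAYED, not discharged: the letters `v_j, a_j`, the Landau copy `(u♮, U₁)` of the (r1)+(r4) row and its
identification `u♮ := u⁻¹`, `U₁ := U^{u}` with S3's gauge (the head's), S3's (152) letters, the (159)-splitting and its three letters, P12's tower ∕ window hypotheses, the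
box-membership facts.  Nothing of [15]∕[4]∕[3] ANALYSIS asserted; `LocalLettersSplitTopStepCore(G∕R)` ∕ `DatumGaugeSplitTopStepCore(G∕R)` ∕ `HalvingStepTop(Core)` ∕
`stub_prop8StepCoP13` NOT discharged; K0⁷ ∕ K1⁹ NOT closed; N07 NOT discharged; counts unmoved (typed 28∕28 · discharged 5∕27); one finite 𝕋⁴ programme at fixed ε — the
route closes the conditional finite-𝕋⁴ rung `BalabanLadder.UV` ONLY; the YM mass gap (Clay) is NOT proved by any of this; nothing continuum ∕ ℝ⁴ ∕ OS.  No `sorry`, no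
`def`, no `instance`, no `notation`.

RELATED IN THE TREE, NOT DUPLICATED (stem check 2026-08-28T10:38Z: `ls …/Theorems | rg -i RecordShear` = ∅; `rg 'recordShear_dominated|recordShear_neg|centredShear_inv_one'`
over lean∕ = ∅): FILE 7 `N07SplitClauseOfShearSize` (the `+`-orientation record door and the three sign-free abstract doors — CONSUMED); dag-n07-w6 `N07ShearSizeTopBox`
(the composed row whose orientation this file matches — cited, not restated).

References: [15] (144) p. 300, (150)–(152) p. 301, (157)–(159) pp. 302–303, (161) p. 303, (164)–(165) p. 304, (168) p. 304; [4] (2.1)–(2.4) p. 224, (2.35) p. 228, (2.60)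
p. 234, Cor. 2.8 (2.150)–(2.151) p. 249; [I.4] (1.13) p. 19, (1.18)–(1.20) p. 20; [3] (78)–(80) p. 30, (85)–(88) p. 31.
-/

set_option autoImplicit false

noncomputable section
open scoped BigOperators Matrix.Norms.L2Operator

namespace Summit.QuantumFields.YangMills.BalabanUVNodes.N07SplitClauseOfRecordShear

open Literature.MathematicalPhysics.QuantumFieldTheory.Balaban1983to89
open Literature.MathematicalPhysics.QuantumFieldTheory.Balaban1983to89.Node00
open Literature.MathematicalPhysics.QuantumFieldTheory.Balaban1983to89.B12RegularSpaces111 (gaugeU expI grad)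
open B5Eq118OneStroke (iterBlockOf)
open B11Eq115Space (levOf)
open B6SectADomainsV1 (Domains)
open B6SectAOperatorsV1 (BondIdx)
open T4Continuum (T4Family)
open T4AxialGaugeSmallField (castSite)
open B16Sect1Backgrounds (toMS)
open GaugeField (gaugeAct)
open MatrixLog (mlog)
open Summit.QuantumFields.YangMills.Theorems.FlatCubeLevels (lamSite_levOf_inOm)
open Summit.QuantumFields.YangMills.Theorems.FlatCubeOpsText (Adm22)
open Summit.QuantumFields.YangMills.Theorems.K0FlatCubeOpsTextP (flatH IsLevWeight)
open Summit.QuantumFields.YangMills.BalabanUVNodes.N07HalvingStepTopOfLocalLetters (Letters10On)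
open Summit.QuantumFields.YangMills.BalabanUVNodes.N07LocalLettersSplitCore (LocalGaugeSplitOn)
open Summit.QuantumFields.YangMills.BalabanUVNodes.N07SplitClauseOfShearSize (norm_mlog_centredShear_inv_le_box_record iterBlockOf_levOf_mem_of_lamSite
  localGaugeSplitOn_of_gauge152_coarseShift_levLift_under_adm22_T4)

variable (F : T4Family) (N : ℕ) [NeZero N]

open scoped Classical in
/-- ★★★ **THE R0′ SPLIT CLAUSE AT THE RECORD's CENTRED SHEAR — SIGN-FREE FAMILY BINDER.**  FILE 7's `localGaugeSplitOn_of_gauge152_recordShear_adm22_T4` verbatim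
except that the shift family `λ` is only DOMINATED by the letter family of dag-n07-w6's composed row (r1)+(r4): `‖λ_j(y)‖ ≤ ‖log ĝ_j(y)⁻¹‖`, `ĝ_j := g_j(castSite lo_j)⁻¹·g_j`,
`g_j := u♮↾T^{(j)}` — so `λ_j := −log ĝ_j⁻¹` (the (r1) orientation, next theorem), `+log ĝ_j⁻¹`, `log ĝ_j` (`‖U⋆ − 1‖ = ‖U − 1‖`) all qualify.  Binders: averaging of record,
torus `K`, height `1 ≤ K − n`, admissible tower `D` with level weights, window `Y`, componentwise extension `H_V` of `flatH`; `u♮, U₁` (DISPLAYED: the head sets `u♮ := u⁻¹`,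
`U₁ := U^{u}` for S3's gauge `u`); per-level boxes `[lo_j, hi_j]` with PER-LEVEL letters `v_j, a_j` and a uniform `σ`, `D_j·(v_j + a_j) ≤ σ ≤ ½` for `j ≤ K − n`; GEOMETRY
(DISPLAYED): outer end-points of `Λ_j`-cells in the level-`j` box, `Λ_j`-sites in it for `j ≥ 1`, fine `Λ₀`-sites under outer end-points in the level-`0` box; `X` the coarse
gradient of `λ` (factor `L^{K−n}∕L^{j(c)}`); S3's gauge of `U` on `Y` with (152) letters `t`; the (159)-splitting `A − H_V X = A₁ + A₂ − A₃` with letters `t₁, t₂, t₃`.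
Conclusion: `LocalGaugeSplitOn Y η_{K−n} t (t₁ + (t₂ + t_∂) + t₃) U` for EVERY `t_∂ > 2CB₃·(4σ)`.
[cite: Balaban1985Variational, (144) p.300, (150)–(152) p.301, (157)–(159) pp.302–303, (161) p.303, (164)–(165) p.304, (168) p.304; Balaban1985Averaging, (85)–(88) p.31; Balaban1984PropagatorsII, (2.1)–(2.4) p.224, (2.35) p.228, (2.60) p.234, Cor. 2.8 (2.150)–(2.151) p.249; Balaban1984PropagatorsI, (1.18)–(1.20) p.20] -/
theorem localGaugeSplitOn_of_gauge152_recordShear_dominated_adm22_T4 :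
    ∃ (Mh₀ R₀ : ℕ) (C δ₀ δ₁ B₃ : ℝ), 0 ≤ C ∧ 0 < δ₀ ∧ 0 < δ₁ ∧ 0 < B₃ ∧
    ∀ (n K : ℕ) (_ : 1 ≤ K - n) (_ : K - n + 1 ≤ F.m + K) {Mh R a' : ℕ} (_ : Mh = F.L ^ a') (_ : Mh₀ ≤ Mh) (_ : R₀ ≤ R) (_ : a' + 3 ≤ F.m + n)
      (D : Domains (F.P K)) (_ : D.k = K - n) (_ : Adm22 D R (F.L * Mh))
      (w : ℕ → PBond (F.P K) 0 → ℝ) (_ : IsLevWeight (F.P K) (K - n) D w)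
      {Y : Set (Site (F.P K) 0)} (_ : ∀ x ∈ Y, D.InOm (K - n) x)
      {HV : (BondIdx D → MatA N) →ₗ[ℂ] (PBond (F.P K) 0 → MatA N)}
      (_ : ∀ (B : BondIdx D → MatA N) (b : PBond (F.P K) 0), HV B b = ∑ c, ((flatH (F.P K) (K - n) D (Pi.single c 1) b : ℝ) : ℂ) • B c)
      -- the (r1)+(r4) row's Landau copy, its gauge, the per-level boxes and their per-level bond letters
      (uL : GaugeTransf (F.P K) 0 (SU N)) (U₁ : GaugeField (F.P K) 0 (SU N)) (lo hi : ℕ → (Fin (F.P K).d → ℤ)) (v a : ℕ → ℝ) {σ : ℝ}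
      (_ : ∀ j, 0 ≤ v j) (_ : ∀ j, 0 ≤ a j) (_ : σ ≤ 1 / 2)
      (_ : ∀ j ≤ K - n, ((∑ κ, (hi j κ - lo j κ).toNat : ℕ) : ℝ) * (v j + a j) ≤ σ)
      (_ : ∀ j ≤ K - n, ∀ c : PBond (F.P K) j, c.src ∈ (castSite '' Set.Icc (lo j) (hi j) : Set (Site (F.P K) j)) →
        c.tgt ∈ (castSite '' Set.Icc (lo j) (hi j) : Set (Site (F.P K) j)) → dist1 (Averaging.iter (avOfRecord F N K) j (gaugeAct uL U₁) c) ≤ v j)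
      (_ : ∀ j ≤ K - n, ∀ c : PBond (F.P K) j, c.src ∈ (castSite '' Set.Icc (lo j) (hi j) : Set (Site (F.P K) j)) →
        c.tgt ∈ (castSite '' Set.Icc (lo j) (hi j) : Set (Site (F.P K) j)) → dist1 (Averaging.iter (avOfRecord F N K) j U₁ c) ≤ a j)
      -- GEOMETRY (displayed)
      (_ : ∀ c : BondIdx D,
        (c.1.2.src ∉ D.Om c.1.1 → c.1.2.src ∈ (castSite '' Set.Icc (lo c.1.1) (hi c.1.1) : Set (Site (F.P K) c.1.1))) ∧
        (c.1.2.tgt ∉ D.Om c.1.1 → c.1.2.tgt ∈ (castSite '' Set.Icc (lo c.1.1) (hi c.1.1) : Set (Site (F.P K) c.1.1))))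
      (_ : ∀ (j : ℕ), 1 ≤ j → ∀ y : Site (F.P K) j, D.LamSite j y → y ∈ (castSite '' Set.Icc (lo j) (hi j) : Set (Site (F.P K) j)))
      (_ : ∀ (c : BondIdx D) (x : Site (F.P K) 0),
        (c.1.2.src ∉ D.Om c.1.1 ∧ iterBlockOf c.1.1 x = c.1.2.src) ∨ (c.1.2.tgt ∉ D.Om c.1.1 ∧ iterBlockOf c.1.1 x = c.1.2.tgt) →
        D.LamSite 0 x → x ∈ (castSite '' Set.Icc (lo 0) (hi 0) : Set (Site (F.P K) 0)))
      -- the shift family, DOMINATED by the (r1) letter family, and its datum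
      (lam : (j : ℕ) → Site (F.P K) j → MatA N)
      (_ : ∀ (j : ℕ) (y : Site (F.P K) j), ‖lam j y‖ ≤ ‖mlog (((((toMS uL j (castSite (lo j)))⁻¹ * toMS uL j y)⁻¹ : SU N)) : MatA N)‖)
      {X : BondIdx D → MatA N}
      (_ : ∀ c : BondIdx D, X c = LatticeFieldCalculus.grad (((F.P K).L : ℝ) ^ (K - n) / ((F.P K).L : ℝ) ^ (c.1.1 : ℕ)) (lam c.1.1) c.1.2)
      -- S3's gauge of `U` on the window and the (159)-splitting of `A − H_V X`
      {U : GaugeField (F.P K) 0 (SU N)} (u : GaugeTransf (F.P K) 0 (SU N)) {A A₁ A₂ A₃ : PBond (F.P K) 0 → MatA N} {t t₁ t₂ t₃ : ℝ}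
      (_ : ∀ b ∈ (Sect2.regionOfSet (F.P K) Y).bonds,
        gaugeU (fun x => ιSU N (u x)) (fun b' => ιSU N (U b')) b = expI ((F.P K).eta (K - n)) (A b))
      (_ : ∀ b ∈ (Sect2.regionOfSet (F.P K) Y).bonds, ‖A b‖ < t)
      (_ : ∀ q ∈ (Sect2.regionOfSet (F.P K) Y).dpairs, ‖grad ((F.P K).eta (K - n)) q.2.1 (fun y => A ⟨y, q.2.2⟩) q.1‖ < t)
      (_ : ∀ b, A b - HV X b = A₁ b + A₂ b - A₃ b)
      (_ : Letters10On Y ((F.P K).eta (K - n)) t₁ A₁) (_ : Letters10On Y ((F.P K).eta (K - n)) t₂ A₂) (_ : Letters10On Y ((F.P K).eta (K - n)) t₃ A₃)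
      {tD : ℝ} (_ : 2 * C * B₃ * (4 * σ) < tD),
      LocalGaugeSplitOn Y ((F.P K).eta (K - n)) t (t₁ + (t₂ + tD) + t₃) U := by
  obtain ⟨Mh₀, R₀, C, δ₀, δ₁, B₃, hC, hδ₀, hδ₁, hB₃, hmain⟩ := localGaugeSplitOn_of_gauge152_coarseShift_levLift_under_adm22_T4 F N
  refine ⟨Mh₀, R₀, C, δ₀, δ₁, B₃, hC, hδ₀, hδ₁, hB₃, ?_⟩
  intro n K hk1 hk' Mh R a' hMha hMh hR hsize D hDk hAdm w hw Y hY HV hHV uL U₁ lo hi v a σ hv0 ha0 hσ hDσ hv ha hboxO hboxS hbox0 lam hlam X hX U u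
    A A₁ A₂ A₃ t t₁ t₂ t₃ he hA hdA h159 h₁ h₂ h₃ tD htD
  -- the size of any dominated family on the level-`j` box, `j ≤ K − n`
  have hlamS : ∀ (j : ℕ) (_ : j ≤ K - n) (y : Site (F.P K) j), y ∈ (castSite '' Set.Icc (lo j) (hi j) : Set (Site (F.P K) j)) →
      ‖lam j y‖ ≤ 2 * σ := by
    intro j hj y hy
    have hjm : j ≤ (F.P K).m + (F.P K).K := (hj.trans hDk.symm.le).trans D.hk
    have hsmall : ((∑ κ, (hi j κ - lo j κ).toNat : ℕ) : ℝ) * (v j + a j) ≤ 1 / 2 := (hDσ j hj).trans hσ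
    exact (hlam j y).trans ((norm_mlog_centredShear_inv_le_box_record F N K uL U₁ hjm (hv0 j) (ha0 j) (hv j hj) (ha j hj) hsmall hy).trans
      (mul_le_mul_of_nonneg_left (hDσ j hj) (by norm_num)))
  have hσ0 : 0 ≤ σ := (mul_nonneg (Nat.cast_nonneg _) (add_nonneg (hv0 0) (ha0 0))).trans (hDσ 0 (Nat.zero_le _))
  have hs0 : 0 ≤ 2 * σ := by positivity
  have hsout : ∀ c : BondIdx D, (c.1.2.src ∉ D.Om c.1.1 → ‖lam c.1.1 c.1.2.src‖ ≤ 2 * σ) ∧ (c.1.2.tgt ∉ D.Om c.1.1 → ‖lam c.1.1 c.1.2.tgt‖ ≤ 2 * σ) :=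
    fun c => ⟨fun h => hlamS _ ((D.le_of_lamBond c.2).trans hDk.le) _ ((hboxO c).1 h),
      fun h => hlamS _ ((D.le_of_lamBond c.2).trans hDk.le) _ ((hboxO c).2 h)⟩
  have hunder : ∀ (c : BondIdx D) (x : Site (F.P K) 0),
      (c.1.2.src ∉ D.Om c.1.1 ∧ iterBlockOf c.1.1 x = c.1.2.src) ∨ (c.1.2.tgt ∉ D.Om c.1.1 ∧ iterBlockOf c.1.1 x = c.1.2.tgt) →
      ‖lam (levOf (fun i => {z : Site (F.P K) 0 | D.InOm i z}) D.k x) (iterBlockOf (levOf (fun i => {z : Site (F.P K) 0 | D.InOm i z}) D.k x) x)‖ ≤ 2 * σ := by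
    intro c x hx
    have hmem := iterBlockOf_levOf_mem_of_lamSite D (fun j => (castSite '' Set.Icc (lo j) (hi j) : Set (Site (F.P K) j))) x hboxS (hbox0 c x hx)
    exact hlamS _ ((D.le_of_lamSite (lamSite_levOf_inOm D x)).trans hDk.le) _ hmem
  have htD' : 2 * C * B₃ * (2 * σ + 2 * σ) < tD := by
    have : 2 * σ + 2 * σ = 4 * σ := by ring
    rw [this]; exact htD
  exact hmain n K hk1 hk' hMha hMh hR hsize D hDk hAdm w hw hY hHV lam hs0 hsout hunder hX u he hA hdA h159 h₁ h₂ h₃ htD'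

open scoped Classical in
/-- ★ **THE (r1) ORIENTATION**: the record door for the family `λ_j(y) = −log ĝ_j(y)⁻¹`, whose coarse gradient `∂^{(j)}λ_j(c) = L^{(K−n)−j}·(log ĝ_j(c₋)⁻¹ − log ĝ_j(c₊)⁻¹)`
IS the shift summand of dag-n07-w6's composed row (r1)+(r4) `norm_mlog_iter_avOfRecord_centred_sub_le` in potential units — so that the head's (159) identity reads
`A − H_V X = A₁ + H_V(B♮ + N) − A₃` with `B♮` the centred data and `N` the BCH remainder (the dominated door with `‖−Z‖ = ‖Z‖`).
[cite: Balaban1985Variational, (152) p.301, (154)–(156) pp.301–302, (157)–(159) pp.302–303, (164)–(165) p.304, (168) p.304; Balaban1985Averaging, (85)–(88) p.31; Balaban1984PropagatorsII, (2.3) p.224, Cor. 2.8 (2.150)–(2.151) p.249; Balaban1984PropagatorsI, (1.20) p.20] -/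
theorem localGaugeSplitOn_of_gauge152_recordShear_neg_adm22_T4 :
    ∃ (Mh₀ R₀ : ℕ) (C δ₀ δ₁ B₃ : ℝ), 0 ≤ C ∧ 0 < δ₀ ∧ 0 < δ₁ ∧ 0 < B₃ ∧
    ∀ (n K : ℕ) (_ : 1 ≤ K - n) (_ : K - n + 1 ≤ F.m + K) {Mh R a' : ℕ} (_ : Mh = F.L ^ a') (_ : Mh₀ ≤ Mh) (_ : R₀ ≤ R) (_ : a' + 3 ≤ F.m + n)
      (D : Domains (F.P K)) (_ : D.k = K - n) (_ : Adm22 D R (F.L * Mh))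
      (w : ℕ → PBond (F.P K) 0 → ℝ) (_ : IsLevWeight (F.P K) (K - n) D w)
      {Y : Set (Site (F.P K) 0)} (_ : ∀ x ∈ Y, D.InOm (K - n) x)
      {HV : (BondIdx D → MatA N) →ₗ[ℂ] (PBond (F.P K) 0 → MatA N)}
      (_ : ∀ (B : BondIdx D → MatA N) (b : PBond (F.P K) 0), HV B b = ∑ c, ((flatH (F.P K) (K - n) D (Pi.single c 1) b : ℝ) : ℂ) • B c)
      (uL : GaugeTransf (F.P K) 0 (SU N)) (U₁ : GaugeField (F.P K) 0 (SU N)) (lo hi : ℕ → (Fin (F.P K).d → ℤ)) (v a : ℕ → ℝ) {σ : ℝ}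
      (_ : ∀ j, 0 ≤ v j) (_ : ∀ j, 0 ≤ a j) (_ : σ ≤ 1 / 2)
      (_ : ∀ j ≤ K - n, ((∑ κ, (hi j κ - lo j κ).toNat : ℕ) : ℝ) * (v j + a j) ≤ σ)
      (_ : ∀ j ≤ K - n, ∀ c : PBond (F.P K) j, c.src ∈ (castSite '' Set.Icc (lo j) (hi j) : Set (Site (F.P K) j)) →
        c.tgt ∈ (castSite '' Set.Icc (lo j) (hi j) : Set (Site (F.P K) j)) → dist1 (Averaging.iter (avOfRecord F N K) j (gaugeAct uL U₁) c) ≤ v j)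
      (_ : ∀ j ≤ K - n, ∀ c : PBond (F.P K) j, c.src ∈ (castSite '' Set.Icc (lo j) (hi j) : Set (Site (F.P K) j)) →
        c.tgt ∈ (castSite '' Set.Icc (lo j) (hi j) : Set (Site (F.P K) j)) → dist1 (Averaging.iter (avOfRecord F N K) j U₁ c) ≤ a j)
      (_ : ∀ c : BondIdx D,
        (c.1.2.src ∉ D.Om c.1.1 → c.1.2.src ∈ (castSite '' Set.Icc (lo c.1.1) (hi c.1.1) : Set (Site (F.P K) c.1.1))) ∧
        (c.1.2.tgt ∉ D.Om c.1.1 → c.1.2.tgt ∈ (castSite '' Set.Icc (lo c.1.1) (hi c.1.1) : Set (Site (F.P K) c.1.1))))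
      (_ : ∀ (j : ℕ), 1 ≤ j → ∀ y : Site (F.P K) j, D.LamSite j y → y ∈ (castSite '' Set.Icc (lo j) (hi j) : Set (Site (F.P K) j)))
      (_ : ∀ (c : BondIdx D) (x : Site (F.P K) 0),
        (c.1.2.src ∉ D.Om c.1.1 ∧ iterBlockOf c.1.1 x = c.1.2.src) ∨ (c.1.2.tgt ∉ D.Om c.1.1 ∧ iterBlockOf c.1.1 x = c.1.2.tgt) →
        D.LamSite 0 x → x ∈ (castSite '' Set.Icc (lo 0) (hi 0) : Set (Site (F.P K) 0)))
      (lam : (j : ℕ) → Site (F.P K) j → MatA N)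
      (_ : ∀ (j : ℕ) (y : Site (F.P K) j), lam j y = -mlog (((((toMS uL j (castSite (lo j)))⁻¹ * toMS uL j y)⁻¹ : SU N)) : MatA N))
      {X : BondIdx D → MatA N}
      (_ : ∀ c : BondIdx D, X c = LatticeFieldCalculus.grad (((F.P K).L : ℝ) ^ (K - n) / ((F.P K).L : ℝ) ^ (c.1.1 : ℕ)) (lam c.1.1) c.1.2)
      {U : GaugeField (F.P K) 0 (SU N)} (u : GaugeTransf (F.P K) 0 (SU N)) {A A₁ A₂ A₃ : PBond (F.P K) 0 → MatA N} {t t₁ t₂ t₃ : ℝ}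
      (_ : ∀ b ∈ (Sect2.regionOfSet (F.P K) Y).bonds,
        gaugeU (fun x => ιSU N (u x)) (fun b' => ιSU N (U b')) b = expI ((F.P K).eta (K - n)) (A b))
      (_ : ∀ b ∈ (Sect2.regionOfSet (F.P K) Y).bonds, ‖A b‖ < t)
      (_ : ∀ q ∈ (Sect2.regionOfSet (F.P K) Y).dpairs, ‖grad ((F.P K).eta (K - n)) q.2.1 (fun y => A ⟨y, q.2.2⟩) q.1‖ < t)
      (_ : ∀ b, A b - HV X b = A₁ b + A₂ b - A₃ b)
      (_ : Letters10On Y ((F.P K).eta (K - n)) t₁ A₁) (_ : Letters10On Y ((F.P K).eta (K - n)) t₂ A₂) (_ : Letters10On Y ((F.P K).eta (K - n)) t₃ A₃)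
      {tD : ℝ} (_ : 2 * C * B₃ * (4 * σ) < tD),
      LocalGaugeSplitOn Y ((F.P K).eta (K - n)) t (t₁ + (t₂ + tD) + t₃) U := by
  obtain ⟨Mh₀, R₀, C, δ₀, δ₁, B₃, hC, hδ₀, hδ₁, hB₃, hmain⟩ := localGaugeSplitOn_of_gauge152_recordShear_dominated_adm22_T4 F N
  refine ⟨Mh₀, R₀, C, δ₀, δ₁, B₃, hC, hδ₀, hδ₁, hB₃, ?_⟩
  intro n K hk1 hk' Mh R a' hMha hMh hR hsize D hDk hAdm w hw Y hY HV hHV uL U₁ lo hi v a σ hv0 ha0 hσ hDσ hv ha hboxO hboxS hbox0 lam hlam X hX U u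
    A A₁ A₂ A₃ t t₁ t₂ t₃ he hA hdA h159 h₁ h₂ h₃ tD htD
  exact hmain n K hk1 hk' hMha hMh hR hsize D hDk hAdm w hw hY hHV uL U₁ lo hi v a hv0 ha0 hσ hDσ hv ha hboxO hboxS hbox0 lam
    (fun j y => by rw [hlam j y, norm_neg]) hX u he hA hdA h159 h₁ h₂ h₃ htD

omit [NeZero N] in
/-- **A6 NON-VACUITY OF THE FAMILY BINDER**: at the trivial gauge `u♮ = 1` the letter family vanishes on every site of every level — `u♮↾T^{(j)} = 1`, `ĝ_j = 1`,
`log 1 = 0` (`MatrixLog.mlog_one`) — so `λ := 0` meets the dominated binder with ANY boxes and letters, and then `X = 0`: the clause is FILE 6's with no shift.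
[cite: Balaban1985Averaging, (78)–(80) p.30 (bookkeeping); Balaban1985Variational, (152) p.301] -/
theorem mlog_centredShear_inv_one {P : Params} (j : ℕ) (y₀ y : Site P j) :
    mlog (((((toMS (fun _ : Site P 0 => (1 : SU N)) j y₀)⁻¹ * toMS (fun _ : Site P 0 => (1 : SU N)) j y)⁻¹ : SU N)) : MatA N) = 0 := by
  have h1 : ∀ z : Site P j, toMS (fun _ : Site P 0 => (1 : SU N)) j z = 1 := fun _ => rfl
  rw [h1, h1, inv_one, one_mul, inv_one]
  exact MatrixLog.mlog_one

end Summit.QuantumFields.YangMills.BalabanUVNodes.N07SplitClauseOfRecordShear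

end
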